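import Summits.AtomisticToContinuum.FouriersLaw.Theses.PorousMediumCorner
import HarnessLib

/-!
# BC3 birth skeleton of the piece `AnchorPositiveDensity` (child of the split of `PorousMediumCorner.AnchorAbelGreenKubo`, stmt-AtomisticToContinuum-9790)

Seam: positivity of the window density at `0` is a time-domain CONDUCTIVITY FLOOR — `liminf_{ν↓0} ∫₀^∞ e^{−νt}C(t)dt > 0`
(stub 1, the physics: the anchor is not an insulator; import slot for an Einstein–Helfand / hydrodynamic test-vector lower
bound on `ν‖(ν − L)⁻¹[J]‖²`, or the Herglotz sign lever) — transported to the frequency side by the Poisson-kernel Abelian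
lemma (stub 2, provable now from the landed `AbelOfSpectralDensity`, stmt-12598: the Abel means converge to `π·g 0`).

`AnchorPositiveDensity` below is a LOCAL copy of the child's statement (byte-identical with children.json / the registered stub
`stub_anchorPositiveDensity` of `Lines/spectral_trichotomy.lean`); after the split it is the route decl
`Summit.AtomisticToContinuum.FouriersLaw.Theses.PorousMediumCorner.AnchorPositiveDensity` and `AnchorPositiveDensity_of` retargets to it by name.
lean check: rc 0, sorries = the two stubs, `AnchorPositiveDensity_of` uses the stubs BY NAME.
-/

noncomputable section

namespace Summit.AtomisticToContinuum.FouriersLaw.Cruxes.AnchorAbelGreenKubo.BirthPositiveDensity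

open MeasureTheory Filter Set Topology
open scoped ENNReal NNReal

/-- Local copy of the piece (see the module docstring). -/
def AnchorPositiveDensity : Prop :=
  ∀ μ γ : ℝ, 0 < μ → ∀ (ρ : MeasureTheory.Measure Literature.MathematicalPhysics.KineticTheory.HeatConduction.ChainConfig) (D : Literature.MathematicalPhysics.KineticTheory.HeatConduction.InfiniteChainDynamics (Literature.MathematicalPhysics.KineticTheory.HeatConduction.OscillatorChain.mk (fun q => μ * q ^ 4 / 4) (fun r => r ^ 4 / 4) γ)), (Literature.MathematicalPhysics.KineticTheory.HeatConduction.OscillatorChain.mk (fun q => μ * q ^ 4 / 4) (fun r => r ^ 4 / 4) γ).IsChainGibbsMeasure 1 ρ → (∀ x : ℤ, MeasureTheory.MeasurePreserving (fun σ : Literature.MathematicalPhysics.KineticTheory.HeatConduction.ChainConfig => fun i : ℤ => σ (i + x)) ρ ρ) → D.PreservesMeasure ρ → (∀ t : ℝ, D.HasAbsConvergentCorrelation ρ t) → ∀ (σ : MeasureTheory.Measure ℝ) (δ : ℝ) (g : ℝ → ℝ), MeasureTheory.IsFiniteMeasure σ → 0 < δ → (∀ t : ℝ, D.currentCorrelation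 ρ t = MeasureTheory.integral σ (fun ω : ℝ => Real.cos (ω * t))) → ContinuousOn g (Set.Ioo (-δ) δ) → (∀ ω ∈ Set.Ioo (-δ) δ, 0 ≤ g ω) → σ.restrict (Set.Ioo (-δ) δ) = (MeasureTheory.volume.restrict (Set.Ioo (-δ) δ)).withDensity (fun ω => ENNReal.ofReal (g ω)) → 0 < g 0

/-- **Stub 1 (physics; conductivity floor).** For every admissible representation of the anchor at `T = 1` the Abel means
of the summed current autocorrelation are bounded below by a positive constant for all small `ν > 0`.
[cite: BonettoLebowitzReyBellet2000, §7 eq. (37)] -/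
theorem stub_abelFloor :
    ∀ μ γ : ℝ, 0 < μ → ∀ (ρ : MeasureTheory.Measure Literature.MathematicalPhysics.KineticTheory.HeatConduction.ChainConfig) (D : Literature.MathematicalPhysics.KineticTheory.HeatConduction.InfiniteChainDynamics (Literature.MathematicalPhysics.KineticTheory.HeatConduction.OscillatorChain.mk (fun q => μ * q ^ 4 / 4) (fun r => r ^ 4 / 4) γ)), (Literature.MathematicalPhysics.KineticTheory.HeatConduction.OscillatorChain.mk (fun q => μ * q ^ 4 / 4) (fun r => r ^ 4 / 4) γ).IsChainGibbsMeasure 1 ρ → (∀ x : ℤ, MeasureTheory.MeasurePreserving (fun σ : Literature.MathematicalPhysics.KineticTheory.HeatConduction.ChainConfig => fun i : ℤ => σ (i + x)) ρ ρ) → D.PreservesMeasure ρ → (∀ t : ℝ, D.HasAbsConvergentCorrelation ρ t) → ∃ c ν₀ : ℝ, 0 < c ∧ 0 < ν₀ ∧ ∀ ν : ℝ, 0 < ν → ν < ν₀ →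
        c ≤ ∫ t in Set.Ioi (0:ℝ), Real.exp (-(ν * t)) * D.currentCorrelation ρ t := by
  sorry

/-- **Stub 2 (analysis, provable now).** If a finite measure `σ` with cosine transform `C` has a continuous non-negative
density `g` on the window `(−δ, δ)` (no atom), an Abel floor `c ≤ ∫₀^∞ e^{−νt}C` for `ν ∈ (0, ν₀)` forces `c ≤ π·g 0`
(the Abel means converge to `π·g 0` by the Poisson-kernel lemma, stmt-12598). [folklore] -/
theorem stub_density_floor_of_abelFloor :
    ∀ (σ : MeasureTheory.Measure ℝ) (C : ℝ → ℝ) (δ : ℝ) (g : ℝ → ℝ) (c ν₀ : ℝ), MeasureTheory.IsFiniteMeasure σ → 0 < δ →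
      (∀ t : ℝ, C t = MeasureTheory.integral σ (fun ω : ℝ => Real.cos (ω * t))) → ContinuousOn g (Set.Ioo (-δ) δ) →
      (∀ ω ∈ Set.Ioo (-δ) δ, 0 ≤ g ω) →
      σ.restrict (Set.Ioo (-δ) δ) = (MeasureTheory.volume.restrict (Set.Ioo (-δ) δ)).withDensity (fun ω => ENNReal.ofReal (g ω)) →
      0 < ν₀ → (∀ ν : ℝ, 0 < ν → ν < ν₀ → c ≤ ∫ t in Set.Ioi (0:ℝ), Real.exp (-(ν * t)) * C t) →
      c ≤ Real.pi * g 0 := by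
  sorry

/-- **`AnchorPositiveDensity_of`**: floor `c > 0` (stub 1) and `c ≤ π·g 0` (stub 2) give `0 < g 0`. [folklore] -/
theorem AnchorPositiveDensity_of : AnchorPositiveDensity := by
  intro μ γ hμ ρ D hG hS hP hA σ δ g hfin hδ hC hg hg0 hres
  obtain ⟨c, ν₀, hc, hν₀, hfloor⟩ := stub_abelFloor μ γ hμ ρ D hG hS hP hA
  have h := stub_density_floor_of_abelFloor σ (D.currentCorrelation ρ) δ g c ν₀ hfin hδ hC hg hg0 hres hν₀ hfloor
  have hπ : 0 < Real.pi := Real.pi_pos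
  exact pos_of_mul_pos_right (hc.trans_le h) hπ.le

end Summit.AtomisticToContinuum.FouriersLaw.Cruxes.AnchorAbelGreenKubo.BirthPositiveDensity

end
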